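import Literature.RingTheory.SymmetricFunctions.RectangleLittlewoodRichardson
import Literature.RepresentationTheory.FiniteGroups.SymmetricGroupFrobeniusFormula
import Literature.NumberTheory.DiophantineGeometry.SymmetricGroupRepsKroneckerCharacterProofs
import Literature.NumberTheory.DiophantineGeometry.GLHighestWeightFacts
import Literature.Computability.AlgebraicComplexity.BLMW11KroneckerApproximation
import Literature.Computability.AlgebraicComplexity.DIP20MonomialCounts
import Mathlib.GroupTheory.Perm.DomMulAct
import HarnessLib

/-!
# Kronecker coefficients of two rectangles and a two-row shape: Sylvester's formula
# `g((N-k,k), (aⁿ), (aⁿ)) = P(k; n × a) - P(k-1; n × a)` (discharge of `BLMW2011_sylvester`)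

Topic `Literature/Computability/AlgebraicComplexity`; a PROOFS file (D-0014): theorems only, no
definition, no named fact. It discharges the named fact
`Literature.Computability.AlgebraicComplexity.BLMW2011_sylvester` of
`BLMW11KroneckerApproximation.lean` — P. Bürgisser, J. M. Landsberg, L. Manivel, J. Weyman, *An
overview of mathematical issues arising in the geometric complexity theory approach to VP ≠ VNP*,
SIAM J. Comput. 40 (2011), §8.3 (8.3.1) ("Sylvester's formula `k_{(δn-b,b),δⁿ,δⁿ} =
P(b; δ×n) - P(b-1; δ×n)`") — by the argument of I. Pak, G. Panova, *Unimodality via Kronecker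
products*, J. Algebraic Combin. 40 (2014), Lemma 1.3 (Main Lemma: `g(m^ℓ, m^ℓ, (n-k,k)) =
p_k(ℓ,m) - p_{k-1}(ℓ,m)`), as rendered by C. Ikenmeyer, G. Panova, Adv. Math. 319 (2017), proof
of Prop. 6.9 (Littlewood's identity, the Jacobi–Trudi expansion of a two-row Schur function and the
Littlewood–Richardson rule for rectangles), here carried out with CHARACTERS of `𝔖_D` through the
tree's Frobenius formula instead of the ring of symmetric functions:

1. **Two-row characters** (`spechtCharacter_twoRow_eq_card_sub_card`): by Frobenius's formula
   with two letters (`spechtCharacter_eq_sum_sign_mul_card`), `χ^{(D-k,k)}(σ) = ψ_k(σ) - ψ_{k-1}(σ)`,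
   `ψ_j(σ) = #{w : [D] → {0,1} fixed by σ with j ones}` (the Jacobi–Trudi step
   `s_{(D-k,k)} = h_{D-k} h_k - h_{D-k+1} h_{k-1}`).
2. **Orbit–stabiliser** (`sum_card_fixed_mul_spechtCharacter_mul`, via the tree's
   `sum_card_filter_mul_eq_sum_sum_stab`): `∑_σ ψ_j(σ) f(σ) = ∑_{|w| = j} ∑_{σ ∈ Stab w} f(σ)`.
3. **The Young subgroup sum** (`sum_stab_spechtCharacter_mul`): for a word `w` with
   fibres of sizes `r, s` and rectangles `R = (aᵇ)`, `R' = (cᵈ)`, by Frobenius's formula for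
   `χ^R` (`b` letters) and `χ^{R'}` (`d` letters), the factorisation of the fixed-word enumerator of
   `σ ∈ Stab w ≅ 𝔖_r × 𝔖_s` over the two fibres and Burnside's count
   (`sum_perm_sum_fixed_prod_eq`),
   `∑_{σ ∈ Stab w} χ^R(σ) χ^{R'}(σ) = |Stab w| · [x^{R+ρ} y^{R'+ρ'}] (a_ρ(x) a_{ρ'}(y) h_r(z) h_s(z))`,
   `z = (x_i y_j)_{i,j}` (Littlewood's identity `⟨s_R s_{R'}, (h_r h_s)⟩ = ∑ c^R_{βα} c^{R'}_{βα}`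
   in coefficient form).
4. **Cauchy + rectangle Littlewood–Richardson** (equal rectangles, `coeff_coeff_rect_eq_card`):
   `[x^{R+ρ} y^{R+ρ}] (a_ρ(x) a_ρ(y) h_r(z) h_s(z)) = ∑_{α ⊢ s, β ⊢ r} (c^R_{βα})²`
   (`cauchySeries_mul_cauchyProd`, `alternant_add_rho`) `= #{α ⊢ s : α ⊆ (aⁿ)}`
   (`coeff_rect_alternant_mul_schur`, `sum_sum_ite_boxCompl_eq_card`).
5. **Assembly**: the master formula `kroneckerCoeff_rect_rect_twoRow_eq` (any two rectangles
   `(aᵇ)`, `(cᵈ)`: `g = E(D-k,k) - E(D-k+1,k-1)` with `E(r,s)` the coefficient of step 3, from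
   `kroneckerCoeff_eq_sum_spechtCharacter_holds`), the count
   `card_filter_antitoneWeights_le_eq_boxPartitionCount` (antitone box vectors = partitions in the
   box, `Weight.existsUnique_eq_ofPartition_holds`), `kroneckerCoeff_rectangle_rectangle_twoRow`:
   `g((δⁿ),(δⁿ),(nδ-k,k)) = p_k(n,δ) - p_{k-1}(n,δ)`, and **`BLMW2011_sylvester_holds`** (with
   `numPartitionsInBox_eq_boxPartitionCount` and the transposition `boxPartitionCount_symm`).

Honest framing (cell val-lit, seat t05): combinatorics of Kronecker coefficients at rectangles;
nothing here bears on VP ≠ VNP, which is NOT proved.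

## References

* [BurgisserEtAl2011] P. Bürgisser, J. M. Landsberg, L. Manivel, J. Weyman, SIAM J. Comput. 40
  (2011) 1179–1209 = arXiv:0907.2850, §8.3 (8.3.1).
* [PakPanova2014Unimodality] I. Pak, G. Panova, J. Algebraic Combin. 40 (2014) 1103–1120 =
  arXiv:1304.5044, Lemma 1.3 and §2 (proof of the Main Lemma).
* [IkenmeyerPanova2017] C. Ikenmeyer, G. Panova, Adv. Math. 319 (2017) 40–66 = arXiv:1512.03798,
  proof of Prop. 6.9 (TeX L1467–1484) and of Prop. 6.4 (L1381–1428).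
* [FultonHarrisGTM129] W. Fulton, J. Harris, *Representation Theory*, Thm. 4.10, §4.3 (4.41),
  Exercise 4.51.

## Mathlib and tree

Mathlib: `DomMulAct.stabilizerMulEquiv` (stabiliser of a word = product of the symmetric groups
of its fibres), `Fintype.prod_fiberwise`, `Finset.prod_univ_sum`, `Equiv.Perm.sign_swap`.
Tree: `spechtCharacter_eq_sum_sign_mul_card`, `spechtCharacter_eq_frobeniusChar`, `frobeniusChar`,
`fixedWordPoly` (`SymmetricGroupFrobeniusFormula`, `SymmetricGroupFixedWords`);
`sum_perm_sum_fixed_prod_eq`, `sum_card_stab_eq_factorial_of_content`,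
`sum_card_filter_mul_eq_sum_sum_stab`, `cauchyProd_mul_prod_geom`, `coeff_prod_geom'`
(`SymmetricGroupFrobeniusOrthogonality`); `cauchySeries_mul_cauchyProd`, `alternant_add_rho`,
`map_schur`, `map_alternant` (`SchurPolynomials`);
`coeff_rect_alternant_mul_schur`, `sum_sum_ite_boxCompl_eq_card` (`RectangleLittlewoodRichardson`);
`kroneckerCoeff_eq_sum_spechtCharacter_holds`; `Weight.existsUnique_eq_ofPartition_holds`,
`Weight.ofPartition_injOn_holds` (`GLHighestWeightFacts`); `numPartitionsInBox`,
`Nat.Partition.twoRow`, `BLMW2011_sylvester` (`BLMW11KroneckerApproximation`); `boxPartitionCount_symm`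
(`DIP20MonomialCounts`).
-/

noncomputable section

open scoped BigOperators
open MvPolynomial Finset Equiv
open Literature.RingTheory.SymmetricFunctions.SymmPoly
open Literature.RepresentationTheory.FiniteGroups
open Literature.NumberTheory.DiophantineGeometry

namespace Literature.Computability.AlgebraicComplexity

/-! ### 1. Two-row characters: `χ^{(D-k,k)} = ψ_k - ψ_{k-1}` -/

/-- The content of a word is its vector of letter counts. [folklore] -/
private theorem wordContent_eq_card {N D : ℕ} (w : Word N D) (j : Fin N) :
    wordContent w j = (univ.filter fun p => w p = j).card := by
  rw [← wordExps_apply_eq_wordContent, wordExps_apply]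

/-- The parts of the two-row partition `(D-k, k)`, `1 ≤ k`, `2k ≤ D`. [cite: BurgisserEtAl2011, §8.3 (8.3.1)] -/
theorem sortedParts_twoRow {D k : ℕ} (hk : 1 ≤ k) (hkD : 2 * k ≤ D) :
    (Nat.Partition.twoRow D k (by omega)).sortedParts = [D - k, k] := by
  have hp : (Nat.Partition.twoRow D k (by omega)).parts = ↑[D - k, k] := by
    simp only [Nat.Partition.twoRow, Nat.Partition.ofSums]
    rw [Multiset.filter_eq_self.mpr]
    · rfl
    · intro a ha
      have : a = D - k ∨ a = k := by simpa using ha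
      omega
  rw [Nat.Partition.sortedParts, hp, Multiset.coe_sort]
  apply List.mergeSort_eq_self
  simp only [List.pairwise_cons, List.mem_singleton, forall_eq, List.not_mem_nil,
    IsEmpty.forall_iff, implies_true, List.Pairwise.nil, and_true, and_self]
  omega

/-- The parts of the one-row partition `(D - 0, 0) = (D)`. [cite: BurgisserEtAl2011, §8.3 (8.3.1)] -/
theorem sortedParts_twoRow_zero (D : ℕ) :
    (Nat.Partition.twoRow D 0 (Nat.zero_le _)).sortedParts = if D = 0 then [] else [D] := by
  have hp : (Nat.Partition.twoRow D 0 (Nat.zero_le _)).parts =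
      if D = 0 then (0 : Multiset ℕ) else ↑[D] := by
    simp only [Nat.Partition.twoRow, Nat.Partition.ofSums, Nat.sub_zero]
    split_ifs with h
    · subst h; decide
    · rw [show ({D, 0} : Multiset ℕ) = ↑[D, 0] from rfl, Multiset.filter_coe]
      simp [h]
  rw [Nat.Partition.sortedParts, hp]
  split_ifs with h
  · simp
  · rw [Multiset.coe_sort]
    exact List.mergeSort_eq_self _ (List.pairwise_singleton _ _)

/-- The padded parts vector of `(D-k, k)` with two letters is `(D-k, k)` (all `k` with `2k ≤ D`).
[cite: BurgisserEtAl2011, §8.3 (8.3.1)] -/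
theorem getD_sortedParts_twoRow {D k : ℕ} (hkD : 2 * k ≤ D) (j : Fin 2) :
    (Nat.Partition.twoRow D k (by omega)).sortedParts.getD (j : ℕ) 0 = ![D - k, k] j := by
  rcases Nat.eq_zero_or_pos k with rfl | hk
  · rw [sortedParts_twoRow_zero]
    fin_cases j <;> split_ifs with h <;> simp [h]
  · rw [sortedParts_twoRow hk hkD]
    fin_cases j <;> simp

/-- `(D-k, k)` has at most two parts. [cite: BurgisserEtAl2011, §8.3 (8.3.1)] -/
theorem card_parts_twoRow_le {D k : ℕ} (hkD : 2 * k ≤ D) :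
    (Nat.Partition.twoRow D k (by omega)).parts.card ≤ 2 := by
  simp only [Nat.Partition.twoRow, Nat.Partition.ofSums]
  refine (Multiset.card_le_card (Multiset.filter_le _ _)).trans ?_
  simp

/-- The two permutations of `Fin 2`. [folklore] -/
private theorem univ_perm_fin_two : (univ : Finset (Perm (Fin 2))) = {1, Equiv.swap 0 1} := by
  decide

/-- **Two-row characters of `𝔖_D` as a difference of permutation characters** (the Jacobi–Trudi /
Young's rule step `χ^{(D-k,k)} = 1↑_{𝔖_{D-k}×𝔖_k} - 1↑_{𝔖_{D-k+1}×𝔖_{k-1}}`, Pak–Panova 2014 §2,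
Ikenmeyer–Panova 2017 proof of Prop. 6.9: "`s_ν = s_k s_{N-k} - s_{k-1} s_{N-k+1}`"), from
Frobenius's formula with two letters: for `2k ≤ D` and every `σ`,
`χ^{(D-k,k)}(σ) = #{w : [D] → {0,1} | w∘σ = w, #w⁻¹(0) = D-k, #w⁻¹(1) = k}
 - #{w | w∘σ = w, #w⁻¹(0) = D-k+1, #w⁻¹(1) + 1 = k}` (the second set is empty for `k = 0`).
[cite: IkenmeyerPanova2017, proof of Prop. 6.9 (TeX L1470–1474)] -/
theorem spechtCharacter_twoRow_eq_card_sub_card {D k : ℕ} (hkD : 2 * k ≤ D) (σ : Perm (Fin D)) :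
    spechtCharacter ℂ (Nat.Partition.twoRow D k (by omega)) σ =
      (((univ : Finset (Fin D → Fin 2)).filter fun w => w ∘ ⇑σ = w ∧
          (univ.filter fun p => w p = 0).card = D - k ∧ (univ.filter fun p => w p = 1).card = k).card
        : ℂ) -
      (((univ : Finset (Fin D → Fin 2)).filter fun w => w ∘ ⇑σ = w ∧
          (univ.filter fun p => w p = 0).card = D - k + 1 ∧
            (univ.filter fun p => w p = 1).card + 1 = k).card : ℂ) := by
  rw [spechtCharacter_eq_sum_sign_mul_card _ (card_parts_twoRow_le hkD) σ, univ_perm_fin_two,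
    Finset.sum_pair (by decide)]
  have hρ0 : rho 2 0 = 1 := by simp [rho_apply]
  have hρ1 : rho 2 1 = 0 := by simp [rho_apply]
  have hlam := getD_sortedParts_twoRow hkD
  simp only [Equiv.Perm.sign_one, Units.val_one, Int.cast_one, one_mul, inv_one, Perm.one_apply,
    Equiv.Perm.sign_swap (show (0 : Fin 2) ≠ 1 by decide), Units.val_neg, Int.cast_neg,
    neg_one_mul, Equiv.swap_inv, ← sub_eq_add_neg]
  congr 3
  · ext w
    simp only [mem_filter, mem_univ, true_and, Fin.forall_fin_two, wordContent_eq_card, hρ0, hρ1]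
    have h0 := hlam 0
    have h1 := hlam 1
    simp only [Matrix.cons_val_zero, Matrix.cons_val_one] at h0 h1
    rw [h0, h1]
    constructor
    · rintro ⟨hw, ha, hb⟩; exact ⟨hw, by omega, by omega⟩
    · rintro ⟨hw, ha, hb⟩; exact ⟨hw, by omega, by omega⟩
  · ext w
    simp only [mem_filter, mem_univ, true_and, Fin.forall_fin_two, wordContent_eq_card,
      Equiv.swap_apply_left, Equiv.swap_apply_right, hρ0, hρ1]
    have h0 := hlam 0
    have h1 := hlam 1
    simp only [Matrix.cons_val_zero, Matrix.cons_val_one] at h0 h1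
    rw [h0, h1]
    constructor
    · rintro ⟨hw, ha, hb⟩; exact ⟨hw, by omega, by omega⟩
    · rintro ⟨hw, ha, hb⟩; exact ⟨hw, by omega, by omega⟩

/-! ### 2. Fixed-word enumerators under ring homomorphisms and coefficient extraction -/

/-- A ring homomorphism applied to the fixed-word enumerator: `φ(F_σ) = ∑_{w∘σ=w} ∏_p φ(X_{w p})`.
[cite: FultonHarrisGTM129, §4.1 (4.10) and §4.3 (4.33)] -/
theorem ringHom_fixedWordPoly {ι : Type*} [Fintype ι] [DecidableEq ι] {N : ℕ} {R : Type*}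
    [CommSemiring R] (φ : MvPolynomial (Fin N) ℤ →+* R) (σ : Perm ι) :
    φ (fixedWordPoly N σ) = ∑ w ∈ univ.filter (fun w : ι → Fin N => w ∘ ⇑σ = w), ∏ p, φ (X (w p)) := by
  unfold fixedWordPoly
  rw [map_sum]
  exact Finset.sum_congr rfl fun w _ => map_prod φ _ _

/-- Extraction of the coefficient of `x^α y^β` from `P(x) Q(y)` in the iterated polynomial ring
`ℤ[y][x]` (two alphabets of sizes `b` and `d`). [cite: FultonHarrisGTM129, §4.3 (4.16)] -/
theorem coeff_coeff_map_mul_C' {b d : ℕ} (P : MvPolynomial (Fin b) ℤ) (Q : MvPolynomial (Fin d) ℤ)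
    (α : Fin b →₀ ℕ) (β : Fin d →₀ ℕ) :
    coeff β (coeff α (MvPolynomial.map (C : ℤ →+* MvPolynomial (Fin d) ℤ) P * C Q)) =
      coeff α P * coeff β Q := by
  rw [mul_comm, coeff_C_mul, coeff_map, mul_comm, coeff_C_mul]

/-! ### 3. The stabiliser of a two-letter word: factorisation over the fibres and Burnside -/

/-- **Fixed words factor over the fibres of `w`.** For `σ` stabilising the word `w : [D] → {0,1}`,
a word `v : [D] → [N]` is fixed by `σ` iff its restrictions to the two fibres `w⁻¹(i)` are fixed by
the restrictions `σ|_{w⁻¹(i)}`, so the enumerator `∑_{v∘σ=v} ∏_p z_{v p}` is the product over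
`i` of the enumerators of the fibres (`F_σ = ∏_{cycles} p_{|c|}` grouped by fibre).
[cite: FultonHarrisGTM129, §4.1 (4.10)] -/
theorem sum_fixed_prod_eq_prod_fibre {D N : ℕ} {R : Type*} [CommSemiring R] (z : Fin N → R)
    (w : Fin D → Fin 2) (σ : Perm (Fin D)) (hσ : w ∘ ⇑σ = w) :
    ∑ v ∈ univ.filter (fun v : Fin D → Fin N => v ∘ ⇑σ = v), ∏ p, z (v p) =
      ∏ i : Fin 2, ∑ u ∈ univ.filter (fun u : {p // w p = i} → Fin N =>
        u ∘ ⇑(σ.subtypePerm (fun p => by rw [show w (σ p) = w p from congr_fun hσ p])) = u),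
        ∏ q, z (u q) := by
  have hwσ : ∀ p, w (σ p) = w p := fun p => congr_fun hσ p
  -- words ↔ families of words on the fibres
  let Θ : (Fin D → Fin N) ≃ ((i : Fin 2) → ({p // w p = i} → Fin N)) :=
    { toFun := fun v i q => v q.1
      invFun := fun g p => g (w p) ⟨p, rfl⟩
      left_inv := fun v => rfl
      right_inv := fun g => by
        funext i q
        obtain ⟨p, hp⟩ := q
        subst hp
        rfl }
  rw [Finset.prod_univ_sum]
  refine Finset.sum_equiv Θ (fun v => ?_) (fun v hv => ?_)
  · simp only [mem_filter, mem_univ, true_and, Fintype.mem_piFinset]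
    constructor
    · intro hv i
      funext q
      simp only [Function.comp_apply, Equiv.Perm.subtypePerm_apply, Θ, Equiv.coe_fn_mk]
      exact congr_fun hv q.1
    · intro h
      funext p
      have := congr_fun (h (w p)) ⟨p, rfl⟩
      simpa [Θ] using this
  · rw [← Fintype.prod_fiberwise w (fun p => z (v p))]
    rfl

/-- A pair of fixed words (alphabets `[b]`, `[d]`) is a fixed word in the alphabet `[b] × [d]`.
[cite: FultonHarrisGTM129, §4.3 (4.15)] -/
theorem sum_fixed_mul_sum_fixed' {ι : Type*} [Fintype ι] [DecidableEq ι] {b d : ℕ} {R : Type*}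
    [CommSemiring R] (x : Fin b → R) (y : Fin d → R) (σ : Perm ι) :
    (∑ w ∈ univ.filter (fun w : ι → Fin b => w ∘ ⇑σ = w), ∏ p, x (w p)) *
      (∑ w ∈ univ.filter (fun w : ι → Fin d => w ∘ ⇑σ = w), ∏ p, y (w p)) =
    ∑ u ∈ univ.filter (fun u : ι → Fin b × Fin d => u ∘ ⇑σ = u),
      ∏ p, (x (u p).1 * y (u p).2) := by
  rw [Finset.sum_mul_sum, ← Finset.sum_product']
  refine Finset.sum_equiv (Equiv.arrowProdEquivProdArrow ι (fun _ => Fin b) (fun _ => Fin d)).symm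
    ?_ ?_
  · rintro ⟨w₁, w₂⟩
    simp only [Finset.mem_product, mem_filter, mem_univ, true_and]
    constructor
    · rintro ⟨h₁, h₂⟩
      funext p
      change (w₁ (σ p), w₂ (σ p)) = (w₁ p, w₂ p)
      exact Prod.ext (congr_fun h₁ p) (congr_fun h₂ p)
    · intro h
      refine ⟨funext fun p => ?_, funext fun p => ?_⟩
      · exact congr_arg Prod.fst (congr_fun h p)
      · exact congr_arg Prod.snd (congr_fun h p)
  · rintro ⟨w₁, w₂⟩ -
    rw [← Finset.prod_mul_distrib]
    rfl

/-- **Burnside's count for pairs of fixed words in two alphabets**: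
`∑_{σ ∈ 𝔖_ι} F_σ(x) F_σ(y) = |ι|! · ∑_{M : [b]×[d] → ℕ, |M| = |ι|} ∏ (x_i y_j)^{M(i,j)}`
(`= |ι|! · h_{|ι|}(x ⊗ y)`). [cite: FultonHarrisGTM129, §4.3 (4.15)] -/
theorem sum_perm_fixedEnum_mul_fixedEnum {ι : Type*} [Fintype ι] [DecidableEq ι] {b d : ℕ}
    {R : Type*} [CommRing R] (x : Fin b → R) (y : Fin d → R) :
    ∑ σ : Perm ι,
      (∑ w ∈ univ.filter (fun w : ι → Fin b => w ∘ ⇑σ = w), ∏ p, x (w p)) *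
      (∑ w ∈ univ.filter (fun w : ι → Fin d => w ∘ ⇑σ = w), ∏ p, y (w p)) =
    (Fintype.card ι).factorial •
      ∑ M ∈ piAntidiag (univ : Finset (Fin b × Fin d)) (Fintype.card ι),
        ∏ q : Fin b × Fin d, (x q.1 * y q.2) ^ M q := by
  simp_rw [sum_fixed_mul_sum_fixed']
  exact sum_perm_sum_fixed_prod_eq (fun q : Fin b × Fin d => x q.1 * y q.2)

/-- **The stabiliser of a two-letter word is the product of the symmetric groups of its fibres,
and its pair enumerator factors accordingly**: for `w : [D] → {0,1}` with fibres of sizes `c₀, c₁`,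
`∑_{σ ∈ Stab w} F_σ(x) F_σ(y) = (c₀! c₁!) · h_{c₀}(x ⊗ y) h_{c₁}(x ⊗ y)` where
`h_r(x ⊗ y) = ∑_{|M| = r} ∏ (x_i y_j)^{M(i,j)}` (Young subgroup `𝔖_{c₀} × 𝔖_{c₁}`; Mathlib's
`DomMulAct.stabilizerMulEquiv`). [cite: FultonHarrisGTM129, §4.3 (4.15) and (4.33)] -/
theorem sum_stab_fixedEnum_mul_fixedEnum {D b d : ℕ} {R : Type*} [CommRing R] (x : Fin b → R)
    (y : Fin d → R) (w : Fin D → Fin 2) :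
    ∑ σ ∈ univ.filter (fun σ : Perm (Fin D) => w ∘ ⇑σ = w),
      (∑ v ∈ univ.filter (fun v : Fin D → Fin b => v ∘ ⇑σ = v), ∏ p, x (v p)) *
      (∑ v ∈ univ.filter (fun v : Fin D → Fin d => v ∘ ⇑σ = v), ∏ p, y (v p)) =
    ((Fintype.card {p // w p = 0}).factorial * (Fintype.card {p // w p = 1}).factorial : ℕ) •
      ((∑ M ∈ piAntidiag (univ : Finset (Fin b × Fin d)) (Fintype.card {p // w p = 0}),
          ∏ q : Fin b × Fin d, (x q.1 * y q.2) ^ M q) *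
        (∑ M ∈ piAntidiag (univ : Finset (Fin b × Fin d)) (Fintype.card {p // w p = 1}),
          ∏ q : Fin b × Fin d, (x q.1 * y q.2) ^ M q)) := by
  -- the fibre enumerators
  let Fx : (i : Fin 2) → Perm {p // w p = i} → R := fun i π =>
    ∑ u ∈ univ.filter (fun u : {p // w p = i} → Fin b => u ∘ ⇑π = u), ∏ q, x (u q)
  let Fy : (i : Fin 2) → Perm {p // w p = i} → R := fun i π =>
    ∑ u ∈ univ.filter (fun u : {p // w p = i} → Fin d => u ∘ ⇑π = u), ∏ q, y (u q)
  -- the equivalence `Stab w ≃ ∏_i Perm(w⁻¹ i)`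
  have hres : ∀ σ : {σ : Perm (Fin D) // w ∘ ⇑σ = w}, ∀ i (p : Fin D), w (σ.1 p) = i ↔ w p = i :=
    fun σ i p => by rw [show w (σ.1 p) = w p from congr_fun σ.2 p]
  let e : {σ : Perm (Fin D) // w ∘ ⇑σ = w} ≃ ((i : Fin 2) → Perm {p // w p = i}) :=
    { toFun := fun σ i => σ.1.subtypePerm (hres σ i)
      invFun := fun g => ⟨DomMulAct.stabilizerEquiv_invFun_aux g,
        funext fun p => DomMulAct.comp_stabilizerEquiv_invFun g p⟩
      left_inv := fun σ => by
        apply Subtype.ext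
        refine Equiv.ext fun p => ?_
        show DomMulAct.stabilizerEquiv_invFun (fun i => σ.1.subtypePerm (hres σ i)) p = σ.1 p
        rw [DomMulAct.stabilizerEquiv_invFun_eq _ rfl]
        rfl
      right_inv := fun g => by
        funext i
        refine Equiv.ext fun q => Subtype.ext ?_
        show DomMulAct.stabilizerEquiv_invFun g q.1 = (g i q).1
        rw [DomMulAct.stabilizerEquiv_invFun_eq g q.2] }
  -- transport the sum
  have step1 : ∑ σ ∈ univ.filter (fun σ : Perm (Fin D) => w ∘ ⇑σ = w),
      (∑ v ∈ univ.filter (fun v : Fin D → Fin b => v ∘ ⇑σ = v), ∏ p, x (v p)) *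
      (∑ v ∈ univ.filter (fun v : Fin D → Fin d => v ∘ ⇑σ = v), ∏ p, y (v p)) =
      ∑ g : (i : Fin 2) → Perm {p // w p = i}, ∏ i, (Fx i (g i) * Fy i (g i)) := by
    rw [Finset.sum_subtype (univ.filter (fun σ : Perm (Fin D) => w ∘ ⇑σ = w))
      (p := fun σ : Perm (Fin D) => w ∘ ⇑σ = w) (fun σ => by simp)]
    refine Fintype.sum_equiv e _ _ fun σ => ?_
    rw [sum_fixed_prod_eq_prod_fibre x w σ.1 σ.2, sum_fixed_prod_eq_prod_fibre y w σ.1 σ.2,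
      ← Finset.prod_mul_distrib]
    rfl
  -- `∑_g ∏_i = ∏_i ∑_π`, then Burnside on each fibre
  have step2 : ∑ g : (i : Fin 2) → Perm {p // w p = i}, ∏ i, (Fx i (g i) * Fy i (g i)) =
      ∏ i : Fin 2, ∑ π : Perm {p // w p = i}, Fx i π * Fy i π := by
    rw [Finset.prod_univ_sum (fun _ => univ) (fun i π => Fx i π * Fy i π), Fintype.piFinset_univ]
  rw [step1, step2]
  simp only [Fx, Fy, sum_perm_fixedEnum_mul_fixedEnum, Fin.prod_univ_two, smul_mul_smul_comm]

/-! ### 4. The Young-subgroup sum of two rectangular Frobenius coefficients -/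

/-- **Littlewood's identity in coefficient form** (the `𝔖_{c₀} × 𝔖_{c₁}`-sum of a product of two
rectangular Frobenius coefficients): for a two-letter word `w` with fibres of sizes `c₀, c₁`,
`∑_{σ ∈ Stab w} X^{(aᵇ)}(σ) X^{(cᵈ)}(σ) = |Stab w| · [x^{a𝟙+ρ_b} y^{c𝟙+ρ_d}] ( a_{ρ_b}(x) a_{ρ_d}(y)
h_{c₀}(x ⊗ y) h_{c₁}(x ⊗ y) )` in `ℤ[y][x]`, where `X^λ(σ) = [x^{λ+ρ}](a_ρ F_σ)` is Frobenius's
coefficient (`frobeniusChar`) and `h_r(x ⊗ y) = ∑_{|M|=r} ∏ (x_i y_j)^{M(i,j)}` — Ikenmeyer–Panova's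
"`s_λ * (s_k s_{n-k}) = ∑ c^λ_{αβ} c^γ_{αβ} s_γ`" paired with `s_μ`, before the Cauchy expansion.
[cite: IkenmeyerPanova2017, proof of Prop. 6.9 (TeX L1467–1470)] -/
theorem sum_stab_frobeniusChar_mul {D b d : ℕ} (a c : ℕ) (w : Fin D → Fin 2) :
    ∑ σ ∈ univ.filter (fun σ : Perm (Fin D) => w ∘ ⇑σ = w),
        frobeniusChar b (fun _ => a) σ * frobeniusChar d (fun _ => c) σ =
      ((univ.filter fun σ : Perm (Fin D) => w ∘ ⇑σ = w).card : ℤ) *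
        coeff (Finsupp.equivFunOnFinite.symm fun j => c + rho d j)
          (coeff (Finsupp.equivFunOnFinite.symm fun j => a + rho b j)
            (alternant (fun i => (X i : MvPolynomial (Fin b) (MvPolynomial (Fin d) ℤ))) (rho b) *
              alternant (fun i => (C (X i) : MvPolynomial (Fin b) (MvPolynomial (Fin d) ℤ))) (rho d) *
              ((∑ M ∈ piAntidiag (univ : Finset (Fin b × Fin d)) (Fintype.card {p // w p = 0}),
                  ∏ q : Fin b × Fin d,
                    ((X q.1 : MvPolynomial (Fin b) (MvPolynomial (Fin d) ℤ)) * C (X q.2)) ^ M q) *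
                (∑ M ∈ piAntidiag (univ : Finset (Fin b × Fin d)) (Fintype.card {p // w p = 1}),
                  ∏ q : Fin b × Fin d,
                    ((X q.1 : MvPolynomial (Fin b) (MvPolynomial (Fin d) ℤ)) * C (X q.2)) ^ M q)))) := by
  set ιx : MvPolynomial (Fin b) ℤ →+* MvPolynomial (Fin b) (MvPolynomial (Fin d) ℤ) := MvPolynomial.map (C : ℤ →+* MvPolynomial (Fin d) ℤ)
    with hιx
  set ιy : MvPolynomial (Fin d) ℤ →+* MvPolynomial (Fin b) (MvPolynomial (Fin d) ℤ) := (C : MvPolynomial (Fin d) ℤ →+* MvPolynomial (Fin b) (MvPolynomial (Fin d) ℤ)) with hιy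
  set α0 : Fin b →₀ ℕ := Finsupp.equivFunOnFinite.symm fun j => a + rho b j with hα0
  set β0 : Fin d →₀ ℕ := Finsupp.equivFunOnFinite.symm fun j => c + rho d j with hβ0
  -- each term as an iterated coefficient
  have hterm : ∀ σ : Perm (Fin D), frobeniusChar b (fun _ => a) σ * frobeniusChar d (fun _ => c) σ =
      coeff β0 (coeff α0 (ιx (alternant (fun i => (X i : MvPolynomial (Fin b) ℤ)) (rho b) *
        fixedWordPoly b σ) * ιy (alternant (fun i => (X i : MvPolynomial (Fin d) ℤ)) (rho d) *
        fixedWordPoly d σ))) := by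
    intro σ
    rw [frobeniusChar_def, frobeniusChar_def, hιx, hιy, coeff_coeff_map_mul_C']
    rfl
  rw [Finset.sum_congr rfl fun σ _ => hterm σ, ← coeff_sum, ← coeff_sum]
  -- pull out the alternants
  have hx : ((ιx : MvPolynomial (Fin b) ℤ →+* MvPolynomial (Fin b) (MvPolynomial (Fin d) ℤ)) ∘ fun i => (X i : MvPolynomial (Fin b) ℤ)) =
      fun i => (X i : MvPolynomial (Fin b) (MvPolynomial (Fin d) ℤ)) := by
    funext i; simp [hιx]
  have hy : ((ιy : MvPolynomial (Fin d) ℤ →+* MvPolynomial (Fin b) (MvPolynomial (Fin d) ℤ)) ∘ fun i => (X i : MvPolynomial (Fin d) ℤ)) =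
      fun i => (C (X i) : MvPolynomial (Fin b) (MvPolynomial (Fin d) ℤ)) := by
    funext i; simp [hιy]
  have hsum : ∑ σ ∈ univ.filter (fun σ : Perm (Fin D) => w ∘ ⇑σ = w),
      ιx (alternant (fun i => (X i : MvPolynomial (Fin b) ℤ)) (rho b) * fixedWordPoly b σ) *
        ιy (alternant (fun i => (X i : MvPolynomial (Fin d) ℤ)) (rho d) * fixedWordPoly d σ) =
      alternant (fun i => (X i : MvPolynomial (Fin b) (MvPolynomial (Fin d) ℤ))) (rho b) * alternant (fun i => (C (X i) : MvPolynomial (Fin b) (MvPolynomial (Fin d) ℤ))) (rho d) *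
        ∑ σ ∈ univ.filter (fun σ : Perm (Fin D) => w ∘ ⇑σ = w),
          (∑ v ∈ univ.filter (fun v : Fin D → Fin b => v ∘ ⇑σ = v), ∏ p, (X (v p) : MvPolynomial (Fin b) (MvPolynomial (Fin d) ℤ))) *
          (∑ v ∈ univ.filter (fun v : Fin D → Fin d => v ∘ ⇑σ = v), ∏ p, (C (X (v p)) : MvPolynomial (Fin b) (MvPolynomial (Fin d) ℤ))) := by
    rw [Finset.mul_sum]
    refine Finset.sum_congr rfl fun σ _ => ?_
    rw [map_mul, map_mul, map_alternant, map_alternant, hx, hy, ringHom_fixedWordPoly,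
      ringHom_fixedWordPoly]
    simp only [hιx, hιy, map_X]
    ring
  rw [hsum, sum_stab_fixedEnum_mul_fixedEnum (fun i => (X i : MvPolynomial (Fin b) (MvPolynomial (Fin d) ℤ))) (fun i => (C (X i) : MvPolynomial (Fin b) (MvPolynomial (Fin d) ℤ))) w]
  -- the cardinality of the stabiliser
  have hcard : (univ.filter fun σ : Perm (Fin D) => w ∘ ⇑σ = w).card =
      (Fintype.card {p // w p = 0}).factorial * (Fintype.card {p // w p = 1}).factorial := by
    rw [← Fintype.card_subtype, DomMulAct.stabilizer_card w, Fin.prod_univ_two]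
  rw [hcard, nsmul_eq_mul]
  set N : ℕ := (Fintype.card {p // w p = 0}).factorial * (Fintype.card {p // w p = 1}).factorial
  rw [show ∀ (A B H : MvPolynomial (Fin b) (MvPolynomial (Fin d) ℤ)), A * B * ((N : MvPolynomial (Fin b) (MvPolynomial (Fin d) ℤ)) * H) = C (C (N : ℤ)) * (A * B * H) from fun A B H => by
      rw [map_natCast, map_natCast]; ring,
    coeff_C_mul, coeff_C_mul]

/-- **The Young-subgroup sum of two rectangular characters**: for partitions `R, R' ⊢ D` whose
padded parts vectors in `b` resp. `d` letters are constant `(a, …, a)` resp. `(c, …, c)` (rectangles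
`(aᵇ)`, `(cᵈ)`, possibly with `a = 0` or `c = 0`), and a two-letter word `w` with fibres of sizes
`c₀, c₁`: `∑_{σ ∈ Stab w} χ^R(σ) χ^{R'}(σ) = |Stab w| · [x^{a𝟙+ρ_b} y^{c𝟙+ρ_d}] (a_{ρ_b}(x)
a_{ρ_d}(y) h_{c₀}(x⊗y) h_{c₁}(x⊗y))` (Frobenius's formula `χ^λ(σ) = [x^{λ+ρ}](a_ρ F_σ)` for both
factors, then `sum_stab_frobeniusChar_mul`). [cite: IkenmeyerPanova2017, proof of Prop. 6.9 (TeX L1467–1470)] -/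
theorem sum_stab_spechtCharacter_mul {D b d : ℕ} (a c : ℕ) (R R' : Nat.Partition D)
    (hRb : R.parts.card ≤ b) (hR : ∀ j : Fin b, R.sortedParts.getD j 0 = a)
    (hR'd : R'.parts.card ≤ d) (hR' : ∀ j : Fin d, R'.sortedParts.getD j 0 = c)
    (w : Fin D → Fin 2) :
    ∑ σ ∈ univ.filter (fun σ : Perm (Fin D) => w ∘ ⇑σ = w),
        spechtCharacter ℂ R σ * spechtCharacter ℂ R' σ =
      ((univ.filter fun σ : Perm (Fin D) => w ∘ ⇑σ = w).card : ℂ) *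
        ((coeff (Finsupp.equivFunOnFinite.symm fun j => c + rho d j)
          (coeff (Finsupp.equivFunOnFinite.symm fun j => a + rho b j)
            (alternant (fun i => (X i : MvPolynomial (Fin b) (MvPolynomial (Fin d) ℤ))) (rho b) *
              alternant (fun i => (C (X i) : MvPolynomial (Fin b) (MvPolynomial (Fin d) ℤ))) (rho d) *
              ((∑ M ∈ piAntidiag (univ : Finset (Fin b × Fin d)) (Fintype.card {p // w p = 0}),
                  ∏ q : Fin b × Fin d,
                    ((X q.1 : MvPolynomial (Fin b) (MvPolynomial (Fin d) ℤ)) * C (X q.2)) ^ M q) *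
                (∑ M ∈ piAntidiag (univ : Finset (Fin b × Fin d)) (Fintype.card {p // w p = 1}),
                  ∏ q : Fin b × Fin d,
                    ((X q.1 : MvPolynomial (Fin b) (MvPolynomial (Fin d) ℤ)) * C (X q.2)) ^ M q)))) : ℤ)
          : ℂ) := by
  have hχR : ∀ σ : Perm (Fin D), spechtCharacter ℂ R σ = (frobeniusChar b (fun _ => a) σ : ℂ) := by
    intro σ
    rw [spechtCharacter_eq_frobeniusChar R hRb σ]
    congr 2
    funext j
    exact hR j
  have hχR' : ∀ σ : Perm (Fin D), spechtCharacter ℂ R' σ = (frobeniusChar d (fun _ => c) σ : ℂ) := by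
    intro σ
    rw [spechtCharacter_eq_frobeniusChar R' hR'd σ]
    congr 2
    funext j
    exact hR' j
  simp_rw [hχR, hχR']
  have h := congr_arg (fun z : ℤ => (z : ℂ)) (sum_stab_frobeniusChar_mul (b := b) (d := d) a c w)
  push_cast at h
  exact h

/-! ### 5. The master formula for `g(R, R', (D-k,k))` -/

/-- The orbit–stabiliser evaluation of `∑_σ ψ(σ) χ^R(σ) χ^{R'}(σ)` for the permutation character
`ψ` of the two-letter words with letter counts `(c₀, c₁)`, `c₀ + c₁ = D`:
`= D! · [x^{a𝟙+ρ} y^{c𝟙+ρ'}] (a_ρ a_{ρ'} h_{c₀} h_{c₁})`. [cite: IkenmeyerPanova2017, proof of Prop. 6.9 (TeX L1467–1474)] -/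
theorem sum_card_fixed_mul_spechtCharacter_mul {D b d : ℕ} (a c : ℕ) (R R' : Nat.Partition D)
    (hRb : R.parts.card ≤ b) (hR : ∀ j : Fin b, R.sortedParts.getD j 0 = a)
    (hR'd : R'.parts.card ≤ d) (hR' : ∀ j : Fin d, R'.sortedParts.getD j 0 = c)
    (c₀ c₁ : ℕ) (hc : c₀ + c₁ = D) :
    ∑ σ : Perm (Fin D),
      (((univ : Finset (Fin D → Fin 2)).filter fun w => w ∘ ⇑σ = w ∧
          (univ.filter fun p => w p = 0).card = c₀ ∧ (univ.filter fun p => w p = 1).card = c₁).card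
        : ℂ) * (spechtCharacter ℂ R σ * spechtCharacter ℂ R' σ) =
      (D.factorial : ℂ) *
        ((coeff (Finsupp.equivFunOnFinite.symm fun j => c + rho d j)
          (coeff (Finsupp.equivFunOnFinite.symm fun j => a + rho b j)
            (alternant (fun i => (X i : MvPolynomial (Fin b) (MvPolynomial (Fin d) ℤ))) (rho b) *
              alternant (fun i => (C (X i) : MvPolynomial (Fin b) (MvPolynomial (Fin d) ℤ))) (rho d) *
              ((∑ M ∈ piAntidiag (univ : Finset (Fin b × Fin d)) c₀,
                  ∏ q : Fin b × Fin d,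
                    ((X q.1 : MvPolynomial (Fin b) (MvPolynomial (Fin d) ℤ)) * C (X q.2)) ^ M q) *
                (∑ M ∈ piAntidiag (univ : Finset (Fin b × Fin d)) c₁,
                  ∏ q : Fin b × Fin d,
                    ((X q.1 : MvPolynomial (Fin b) (MvPolynomial (Fin d) ℤ)) * C (X q.2)) ^ M q)))) : ℤ)
          : ℂ) := by
  set W := (univ : Finset (Fin D → Fin 2)).filter fun w =>
    (univ.filter fun p => w p = 0).card = c₀ ∧ (univ.filter fun p => w p = 1).card = c₁ with hW
  -- the counting function is `#{w ∈ W | w ∘ σ = w}`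
  have hA : ∀ σ : Perm (Fin D),
      ((univ : Finset (Fin D → Fin 2)).filter fun w => w ∘ ⇑σ = w ∧
          (univ.filter fun p => w p = 0).card = c₀ ∧ (univ.filter fun p => w p = 1).card = c₁) =
        W.filter fun w => w ∘ ⇑σ = w := by
    intro σ
    ext w
    simp only [hW, mem_filter, mem_univ, true_and]
    tauto
  simp_rw [hA]
  rw [sum_card_filter_mul_eq_sum_sum_stab W]
  -- evaluate each stabiliser sum
  have hfib : ∀ w ∈ W, Fintype.card {p // w p = 0} = c₀ ∧ Fintype.card {p // w p = 1} = c₁ := by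
    intro w hw
    simp only [hW, mem_filter, mem_univ, true_and] at hw
    rw [Fintype.card_subtype, Fintype.card_subtype]
    exact hw
  have hinner : ∀ w ∈ W, ∑ σ ∈ stabFinset w, spechtCharacter ℂ R σ * spechtCharacter ℂ R' σ =
      ((univ.filter fun σ : Perm (Fin D) => w ∘ ⇑σ = w).card : ℂ) *
        ((coeff (Finsupp.equivFunOnFinite.symm fun j => c + rho d j)
          (coeff (Finsupp.equivFunOnFinite.symm fun j => a + rho b j)
            (alternant (fun i => (X i : MvPolynomial (Fin b) (MvPolynomial (Fin d) ℤ))) (rho b) *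
              alternant (fun i => (C (X i) : MvPolynomial (Fin b) (MvPolynomial (Fin d) ℤ))) (rho d) *
              ((∑ M ∈ piAntidiag (univ : Finset (Fin b × Fin d)) c₀,
                  ∏ q : Fin b × Fin d,
                    ((X q.1 : MvPolynomial (Fin b) (MvPolynomial (Fin d) ℤ)) * C (X q.2)) ^ M q) *
                (∑ M ∈ piAntidiag (univ : Finset (Fin b × Fin d)) c₁,
                  ∏ q : Fin b × Fin d,
                    ((X q.1 : MvPolynomial (Fin b) (MvPolynomial (Fin d) ℤ)) * C (X q.2)) ^ M q)))) : ℤ)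
          : ℂ) := by
    intro w hw
    rw [← filter_comp_eq_stabFinset, sum_stab_spechtCharacter_mul a c R R' hRb hR hR'd hR' w,
      (hfib w hw).1, (hfib w hw).2]
  rw [Finset.sum_congr rfl hinner, ← Finset.sum_mul]
  congr 1
  -- `∑_{w ∈ W} |Stab w| = D!`
  have h := sum_card_stab_eq_factorial_of_content (ι := Fin D) (α := Fin 2) ![c₀, c₁]
    (by rw [Fin.sum_univ_two, Fintype.card_fin]; simpa using hc)
  rw [Fintype.card_fin] at h
  rw [hW, ← Nat.cast_sum, ← h]
  congr 1
  refine Finset.sum_congr ?_ fun _ _ => rfl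
  ext w
  simp only [mem_filter, mem_univ, true_and, Fin.forall_fin_two, Matrix.cons_val_zero,
    Matrix.cons_val_one]

/-- **The master formula**: for partitions `R, R' ⊢ D` with padded parts vectors `(aᵇ)`, `(cᵈ)`
(rectangles) and the two-row shape `(D-k, k)`, `2k ≤ D`,
`g(R, R', (D-k,k)) = E(D-k, k) - E(D-k+1, k-1)` (second term absent for `k = 0`), where
`E(r,s) = [x^{a𝟙+ρ_b} y^{c𝟙+ρ_d}] ( a_{ρ_b}(x) a_{ρ_d}(y) h_r(x⊗y) h_s(x⊗y) ) ∈ ℤ`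
(`= ∑_{α ⊢ s, β ⊢ r} c^R_{βα} c^{R'}_{βα}`): the character formula for Kronecker coefficients,
the two-row character as a difference of permutation characters, orbit–stabiliser and
Littlewood's identity in coefficient form (Pak–Panova 2014 Lemma 1.3 / Ikenmeyer–Panova 2017
proof of Prop. 6.9, through characters). [cite: IkenmeyerPanova2017, proof of Prop. 6.9 (TeX L1467–1476)] -/
theorem kroneckerCoeff_rect_rect_twoRow_eq {D b d : ℕ} (a c : ℕ) (R R' : Nat.Partition D)
    (hRb : R.parts.card ≤ b) (hR : ∀ j : Fin b, R.sortedParts.getD j 0 = a)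
    (hR'd : R'.parts.card ≤ d) (hR' : ∀ j : Fin d, R'.sortedParts.getD j 0 = c)
    {k : ℕ} (hkD : 2 * k ≤ D) :
    (kroneckerCoeff ℂ R R' (Nat.Partition.twoRow D k (by omega)) : ℤ) =
      coeff (Finsupp.equivFunOnFinite.symm fun j => c + rho d j)
          (coeff (Finsupp.equivFunOnFinite.symm fun j => a + rho b j)
            (alternant (fun i => (X i : MvPolynomial (Fin b) (MvPolynomial (Fin d) ℤ))) (rho b) *
              alternant (fun i => (C (X i) : MvPolynomial (Fin b) (MvPolynomial (Fin d) ℤ))) (rho d) *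
              ((∑ M ∈ piAntidiag (univ : Finset (Fin b × Fin d)) (D - k),
                  ∏ q : Fin b × Fin d,
                    ((X q.1 : MvPolynomial (Fin b) (MvPolynomial (Fin d) ℤ)) * C (X q.2)) ^ M q) *
                (∑ M ∈ piAntidiag (univ : Finset (Fin b × Fin d)) k,
                  ∏ q : Fin b × Fin d,
                    ((X q.1 : MvPolynomial (Fin b) (MvPolynomial (Fin d) ℤ)) * C (X q.2)) ^ M q)))) -
      (if k = 0 then 0 else
        coeff (Finsupp.equivFunOnFinite.symm fun j => c + rho d j)
          (coeff (Finsupp.equivFunOnFinite.symm fun j => a + rho b j)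
            (alternant (fun i => (X i : MvPolynomial (Fin b) (MvPolynomial (Fin d) ℤ))) (rho b) *
              alternant (fun i => (C (X i) : MvPolynomial (Fin b) (MvPolynomial (Fin d) ℤ))) (rho d) *
              ((∑ M ∈ piAntidiag (univ : Finset (Fin b × Fin d)) (D - k + 1),
                  ∏ q : Fin b × Fin d,
                    ((X q.1 : MvPolynomial (Fin b) (MvPolynomial (Fin d) ℤ)) * C (X q.2)) ^ M q) *
                (∑ M ∈ piAntidiag (univ : Finset (Fin b × Fin d)) (k - 1),
                  ∏ q : Fin b × Fin d,
                    ((X q.1 : MvPolynomial (Fin b) (MvPolynomial (Fin d) ℤ)) * C (X q.2)) ^ M q))))) := by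
  -- abbreviate the two coefficients
  set E₁ : ℤ := coeff (Finsupp.equivFunOnFinite.symm fun j => c + rho d j)
          (coeff (Finsupp.equivFunOnFinite.symm fun j => a + rho b j)
            (alternant (fun i => (X i : MvPolynomial (Fin b) (MvPolynomial (Fin d) ℤ))) (rho b) *
              alternant (fun i => (C (X i) : MvPolynomial (Fin b) (MvPolynomial (Fin d) ℤ))) (rho d) *
              ((∑ M ∈ piAntidiag (univ : Finset (Fin b × Fin d)) (D - k),
                  ∏ q : Fin b × Fin d,
                    ((X q.1 : MvPolynomial (Fin b) (MvPolynomial (Fin d) ℤ)) * C (X q.2)) ^ M q) *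
                (∑ M ∈ piAntidiag (univ : Finset (Fin b × Fin d)) k,
                  ∏ q : Fin b × Fin d,
                    ((X q.1 : MvPolynomial (Fin b) (MvPolynomial (Fin d) ℤ)) * C (X q.2)) ^ M q))))
    with hE₁
  set E₂ : ℤ := coeff (Finsupp.equivFunOnFinite.symm fun j => c + rho d j)
          (coeff (Finsupp.equivFunOnFinite.symm fun j => a + rho b j)
            (alternant (fun i => (X i : MvPolynomial (Fin b) (MvPolynomial (Fin d) ℤ))) (rho b) *
              alternant (fun i => (C (X i) : MvPolynomial (Fin b) (MvPolynomial (Fin d) ℤ))) (rho d) *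
              ((∑ M ∈ piAntidiag (univ : Finset (Fin b × Fin d)) (D - k + 1),
                  ∏ q : Fin b × Fin d,
                    ((X q.1 : MvPolynomial (Fin b) (MvPolynomial (Fin d) ℤ)) * C (X q.2)) ^ M q) *
                (∑ M ∈ piAntidiag (univ : Finset (Fin b × Fin d)) (k - 1),
                  ∏ q : Fin b × Fin d,
                    ((X q.1 : MvPolynomial (Fin b) (MvPolynomial (Fin d) ℤ)) * C (X q.2)) ^ M q))))
    with hE₂
  -- the character formula
  have key := kroneckerCoeff_eq_sum_spechtCharacter_holds (k := ℂ) R R'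
    (Nat.Partition.twoRow D k (by omega))
  simp_rw [spechtCharacter_twoRow_eq_card_sub_card hkD, mul_sub, Finset.sum_sub_distrib] at key
  have hplus : ∑ σ : Perm (Fin D), spechtCharacter ℂ R σ * spechtCharacter ℂ R' σ *
      (((univ : Finset (Fin D → Fin 2)).filter fun w => w ∘ ⇑σ = w ∧
        (univ.filter fun p => w p = 0).card = D - k ∧ (univ.filter fun p => w p = 1).card = k).card
        : ℂ) = (D.factorial : ℂ) * (E₁ : ℂ) := by
    rw [← sum_card_fixed_mul_spechtCharacter_mul a c R R' hRb hR hR'd hR' (D - k) k (by omega)]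
    exact Finset.sum_congr rfl fun σ _ => by ring
  have hminus : ∑ σ : Perm (Fin D), spechtCharacter ℂ R σ * spechtCharacter ℂ R' σ *
      (((univ : Finset (Fin D → Fin 2)).filter fun w => w ∘ ⇑σ = w ∧
        (univ.filter fun p => w p = 0).card = D - k + 1 ∧
          (univ.filter fun p => w p = 1).card + 1 = k).card : ℂ) =
      (D.factorial : ℂ) * ((if k = 0 then 0 else E₂ : ℤ) : ℂ) := by
    rcases Nat.eq_zero_or_pos k with rfl | hk
    · rw [if_pos rfl, Int.cast_zero, mul_zero]
      refine Finset.sum_eq_zero fun σ _ => ?_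
      rw [Finset.card_eq_zero.mpr, Nat.cast_zero, mul_zero]
      rw [Finset.filter_eq_empty_iff]
      intro w _ h
      exact Nat.succ_ne_zero _ h.2.2
    · rw [if_neg (by omega),
        ← sum_card_fixed_mul_spechtCharacter_mul a c R R' hRb hR hR'd hR' (D - k + 1) (k - 1)
          (by omega)]
      refine Finset.sum_congr rfl fun σ _ => ?_
      rw [mul_comm]
      congr 3
      ext w
      simp only [mem_filter, mem_univ, true_and]
      constructor
      · rintro ⟨h1, h2, h3⟩; exact ⟨h1, h2, by omega⟩
      · rintro ⟨h1, h2, h3⟩; exact ⟨h1, h2, by omega⟩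
  rw [hplus, hminus, ← mul_sub, ← Int.cast_sub] at key
  -- cancel `D!`
  have key' : ((D.factorial * kroneckerCoeff ℂ R R' (Nat.Partition.twoRow D k (by omega)) : ℕ) : ℤ)
      = (D.factorial : ℤ) * (E₁ - if k = 0 then 0 else E₂) := by
    have := key
    norm_cast at this ⊢
  rw [Nat.cast_mul] at key'
  exact mul_left_cancel₀ (by exact_mod_cast D.factorial_ne_zero) key'

/-! ### 6. Littlewood's identity in coefficient form: `E(r,s)` for two equal rectangles -/

/-- Cauchy's identity, degree by degree: `h_D(x ⊗ y) = ∑_{M : [n]² → ℕ, |M| = D} ∏ (x_i y_j)^{M_{ij}}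
= ∑_{λ ∈ ℕⁿ antitone, |λ| = D} s_λ(x) s_λ(y)` (the `T^D`-coefficient of
`∑_λ s_λ(x) s_λ(y) T^{|λ|} = ∏_{i,j} (1 - x_i y_j T)⁻¹`). [cite: Macdonald1995, Ch. I §4 (4.3)] -/
theorem sum_piAntidiag_prod_pow_eq_sum_schur_mul_schur {R : Type*} [CommRing R] {n : ℕ}
    (x y : Fin n → R) (D : ℕ) :
    ∑ M ∈ piAntidiag (univ : Finset (Fin n × Fin n)) D, ∏ c, (x c.1 * y c.2) ^ M c =
      ∑ la ∈ antitoneWeights n D, schur x la * schur y la := by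
  have h : cauchySeries x y = ∏ c : Fin n × Fin n, geom (x c.1 * y c.2) := by
    calc cauchySeries x y
        = cauchySeries x y * (cauchyProd x y * ∏ c : Fin n × Fin n, geom (x c.1 * y c.2)) := by
          rw [cauchyProd_mul_prod_geom, mul_one]
      _ = ∏ c : Fin n × Fin n, geom (x c.1 * y c.2) := by
          rw [← mul_assoc, cauchySeries_mul_cauchyProd, one_mul]
  rw [← coeff_prod_geom', ← h, cauchySeries, PowerSeries.coeff_mk]

/-- One term of Littlewood's identity in `ℤ[y][x]`: for the generic alphabets `x = (X_i)`,
`y = (C X_i)`, `a_ρ(x) a_ρ(y) · (s_β(x) s_β(y)) · (s_α(x) s_α(y)) = P(x) · P(y)` with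
`P = a_{β+ρ} s_α ∈ ℤ[x]` (bialternant formula). [folklore] -/
private theorem alternant_mul_schur_mul_schur_eq_map_mul_C {n : ℕ} (α β : Fin n → ℕ) :
    alternant (fun i => (X i : MvPolynomial (Fin n) (MvPolynomial (Fin n) ℤ))) (rho n) *
        alternant (fun i => (C (X i) : MvPolynomial (Fin n) (MvPolynomial (Fin n) ℤ))) (rho n) *
        (schur (fun i => (X i : MvPolynomial (Fin n) (MvPolynomial (Fin n) ℤ))) β *
            schur (fun i => (C (X i) : MvPolynomial (Fin n) (MvPolynomial (Fin n) ℤ))) β *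
          (schur (fun i => (X i : MvPolynomial (Fin n) (MvPolynomial (Fin n) ℤ))) α *
            schur (fun i => (C (X i) : MvPolynomial (Fin n) (MvPolynomial (Fin n) ℤ))) α)) =
      MvPolynomial.map (C : ℤ →+* MvPolynomial (Fin n) ℤ)
          (alternant (fun i => (X i : MvPolynomial (Fin n) ℤ)) (β + rho n) *
            schur (fun i => (X i : MvPolynomial (Fin n) ℤ)) α) *
        C (alternant (fun i => (X i : MvPolynomial (Fin n) ℤ)) (β + rho n) *
            schur (fun i => (X i : MvPolynomial (Fin n) ℤ)) α) := by
  have hx : (⇑(MvPolynomial.map (C : ℤ →+* MvPolynomial (Fin n) ℤ)) ∘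
      fun i : Fin n => (X i : MvPolynomial (Fin n) ℤ)) =
        fun i => (X i : MvPolynomial (Fin n) (MvPolynomial (Fin n) ℤ)) :=
    funext fun i => map_X _ i
  have hy : (⇑(C : MvPolynomial (Fin n) ℤ →+* MvPolynomial (Fin n) (MvPolynomial (Fin n) ℤ)) ∘
      fun i : Fin n => (X i : MvPolynomial (Fin n) ℤ)) =
        fun i => (C (X i) : MvPolynomial (Fin n) (MvPolynomial (Fin n) ℤ)) := rfl
  rw [map_mul, map_mul, map_alternant, map_schur, map_alternant, map_schur, hx, hy,
    alternant_add_rho, alternant_add_rho]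
  ring

/-- **`E(r,s)` for two equal rectangles**: for `r + s = n·a`,
`[x^{a𝟙+ρ} y^{a𝟙+ρ}] (a_ρ(x) a_ρ(y) h_r(x⊗y) h_s(x⊗y)) = ∑_{β ⊢ r, α ⊢ s} (c^{(aⁿ)}_{βα})²
= #{α ∈ ℕⁿ antitone : |α| = s, α ⊆ (aⁿ)}` — Cauchy's identity twice, the bialternant formula,
extraction of `x^· y^·`-coefficients of `P(x) P(y)`, and the Littlewood–Richardson rule for the
rectangle (`coeff_rect_alternant_mul_schur`: `c^{(aⁿ)}_{βα} = [β = complement of α in a × n]`).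
[cite: IkenmeyerPanova2017, proof of Prop. 6.9 (TeX L1474–1480)] -/
theorem coeff_coeff_rect_eq_card {n : ℕ} (a : ℕ) {r s : ℕ} (hrs : r + s = n * a) :
    coeff (Finsupp.equivFunOnFinite.symm fun j => a + rho n j)
        (coeff (Finsupp.equivFunOnFinite.symm fun j => a + rho n j)
          (alternant (fun i => (X i : MvPolynomial (Fin n) (MvPolynomial (Fin n) ℤ))) (rho n) *
            alternant (fun i => (C (X i) : MvPolynomial (Fin n) (MvPolynomial (Fin n) ℤ))) (rho n) *
            ((∑ M ∈ piAntidiag (univ : Finset (Fin n × Fin n)) r,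
                ∏ q : Fin n × Fin n,
                  ((X q.1 : MvPolynomial (Fin n) (MvPolynomial (Fin n) ℤ)) * C (X q.2)) ^ M q) *
              (∑ M ∈ piAntidiag (univ : Finset (Fin n × Fin n)) s,
                ∏ q : Fin n × Fin n,
                  ((X q.1 : MvPolynomial (Fin n) (MvPolynomial (Fin n) ℤ)) * C (X q.2)) ^ M q)))) =
      (((antitoneWeights n s).filter fun α => ∀ i, α i ≤ a).card : ℤ) := by
  rw [sum_piAntidiag_prod_pow_eq_sum_schur_mul_schur
      (fun i => (X i : MvPolynomial (Fin n) (MvPolynomial (Fin n) ℤ)))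
      (fun i => (C (X i) : MvPolynomial (Fin n) (MvPolynomial (Fin n) ℤ))) r,
    sum_piAntidiag_prod_pow_eq_sum_schur_mul_schur
      (fun i => (X i : MvPolynomial (Fin n) (MvPolynomial (Fin n) ℤ)))
      (fun i => (C (X i) : MvPolynomial (Fin n) (MvPolynomial (Fin n) ℤ))) s,
    Finset.sum_mul_sum, Finset.mul_sum]
  simp_rw [Finset.mul_sum, alternant_mul_schur_mul_schur_eq_map_mul_C, coeff_sum,
    coeff_coeff_map_mul_C', ← sum_sum_ite_boxCompl_eq_card a hrs]
  refine Finset.sum_congr rfl fun β hβ => Finset.sum_congr rfl fun α hα => ?_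
  rw [coeff_rect_alternant_mul_schur a (mem_antitoneWeights.1 hα).2 (mem_antitoneWeights.1 hβ).2]
  split_ifs <;> simp

/-! ### 7. Antitone box vectors are the partitions in the box -/

/-- The antitone vectors `α ∈ ℕⁿ` with `|α| = s` and all entries `≤ a` are the zero-padded parts
vectors of the partitions of `s` with at most `n` parts, each at most `a`; their number is
`p_s(n, a)` (`boxPartitionCount`). [cite: DorflerIkenmeyerPanova2020, §4 (arXiv p. 9)] -/
theorem card_filter_antitoneWeights_le_eq_boxPartitionCount (n a s : ℕ) :
    ((antitoneWeights n s).filter fun α => ∀ i, α i ≤ a).card = boxPartitionCount s n a := by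
  classical
  rw [boxPartitionCount, Nat.card_eq_fintype_card, Fintype.card_subtype]
  symm
  refine Finset.card_bij (fun μ _ => fun i : Fin n => μ.sortedParts.getD i 0) ?_ ?_ ?_
  · intro μ hμ
    simp only [mem_filter, mem_univ, true_and] at hμ
    rw [mem_filter, mem_antitoneWeights]
    refine ⟨⟨sum_getD_sortedParts μ hμ.1, getD_sortedParts_antitone μ⟩, fun i => ?_⟩
    show μ.sortedParts.getD i 0 ≤ a
    by_cases hi : (i : ℕ) < μ.sortedParts.length
    · rw [List.getD_eq_getElem _ _ hi]
      exact hμ.2 _ ((Multiset.mem_sort _).mp (List.getElem_mem hi))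
    · rw [List.getD_eq_default _ _ (not_lt.mp hi)]
      exact Nat.zero_le _
  · intro μ hμ ν hν h
    simp only [mem_filter, mem_univ, true_and] at hμ hν
    refine Weight.ofPartition_injOn_holds n s hμ.1 hν.1 ?_
    funext i
    rw [Weight.ofPartition_apply, Weight.ofPartition_apply, congrFun h i]
  · intro α hα
    rw [mem_filter, mem_antitoneWeights] at hα
    obtain ⟨⟨hsum, hanti⟩, hle⟩ := hα
    have hχ : Weight.IsPolynomial (fun i => (α i : ℤ) : Weight (Fin n)) :=
      ⟨fun i j hij => Int.ofNat_le.mpr (hanti hij), fun i => Int.natCast_nonneg (α i)⟩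
    obtain ⟨μ, ⟨hμn, hμχ⟩, -⟩ := Weight.existsUnique_eq_ofPartition_holds hχ
    have hsize : (Weight.size (fun i => (α i : ℤ) : Weight (Fin n))).toNat = s := by
      simp only [Weight.size]
      rw [← Nat.cast_sum, hsum, Int.toNat_natCast]
    have hget : ∀ i : Fin n, μ.sortedParts.getD i 0 = α i := fun i => by
      have := congrFun hμχ i
      rw [Weight.ofPartition_apply] at this
      exact_mod_cast this
    refine ⟨⟨μ.parts, μ.parts_pos, by rw [μ.parts_sum, hsize]⟩, ?_, funext fun i => hget i⟩
    simp only [mem_filter, mem_univ, true_and]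
    refine ⟨hμn, fun x hx => ?_⟩
    have hx' : x ∈ μ.sortedParts := (Multiset.mem_sort _).mpr hx
    obtain ⟨i, hi, hix⟩ := List.getElem_of_mem hx'
    have hin : i < n := by
      rw [Nat.Partition.length_sortedParts] at hi
      exact lt_of_lt_of_le hi hμn
    rw [← hix, ← List.getD_eq_getElem _ 0 hi, show i = ((⟨i, hin⟩ : Fin n) : ℕ) from rfl, hget]
    exact hle _

/-- `P(b; r × c) = p_b(r, c)`: the tree's two counts of the partitions of `b` in an `r × c` box
(`numPartitionsInBox` of `BLMW11KroneckerApproximation`, a `Finset` cardinality, and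
`boxPartitionCount` of `DIP20MultiplicityObstructions`, a `Nat.card`) agree. [cite: BurgisserEtAl2011, §8.3 (8.3.1)] -/
theorem numPartitionsInBox_eq_boxPartitionCount (b r c : ℕ) :
    numPartitionsInBox b r c = boxPartitionCount b r c := by
  rw [numPartitionsInBox, boxPartitionCount, Nat.card_eq_fintype_card]
  exact (Fintype.card_of_subtype _ fun μ => by rw [mem_filter, and_iff_right (mem_univ _)]).symm

/-! ### 8. Sylvester's formula -/

/-- The padded parts vector of the `m × d` rectangle in `m` letters is constant `d`. [folklore] -/
private theorem getD_sortedParts_rectangle_fin (m d : ℕ) (j : Fin m) :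
    (Nat.Partition.rectangle m d).sortedParts.getD j 0 = d := by
  rcases Nat.eq_zero_or_pos d with rfl | hd
  · have h0 : (Nat.Partition.rectangle m 0).sortedParts = [] := by
      rw [← List.length_eq_zero_iff, Nat.Partition.length_sortedParts]
      simp [Nat.Partition.rectangle, Nat.Partition.ofSums]
    rw [h0, List.getD_nil]
  · rw [Nat.Partition.sortedParts_rectangle _ _ hd.ne', List.getD_replicate _ j.2]

/-- **Pak–Panova's Main Lemma / Sylvester's formula, signed form**: for all `n, δ, k` with
`2k ≤ nδ`, `g((δⁿ), (δⁿ), (nδ - k, k)) = p_k(n, δ) - p_{k-1}(n, δ)` (`p_{-1} = 0`), where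
`p_k(n, δ)` is the number of partitions of `k` in the `n × δ` box (Pak–Panova 2014, Lemma 1.3
"`g(m^ℓ, m^ℓ, (n-k,k)) = p_k(ℓ,m) - p_{k-1}(ℓ,m)`"; Ikenmeyer–Panova 2017, proof of Prop. 6.9).
[cite: PakPanova2014Unimodality, Lemma 1.3] [cite: IkenmeyerPanova2017, proof of Prop. 6.9 (TeX L1467–1484)] -/
theorem kroneckerCoeff_rectangle_rectangle_twoRow (n δ k : ℕ) (hk : 2 * k ≤ n * δ) :
    (kroneckerCoeff ℂ (Nat.Partition.rectangle n δ) (Nat.Partition.rectangle n δ)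
        (Nat.Partition.twoRow (n * δ) k (by omega)) : ℤ) =
      (boxPartitionCount k n δ : ℤ) - if k = 0 then 0 else (boxPartitionCount (k - 1) n δ : ℤ) := by
  rw [kroneckerCoeff_rect_rect_twoRow_eq δ δ (Nat.Partition.rectangle n δ)
      (Nat.Partition.rectangle n δ) (Nat.Partition.card_parts_rectangle_le n δ)
      (getD_sortedParts_rectangle_fin n δ) (Nat.Partition.card_parts_rectangle_le n δ)
      (getD_sortedParts_rectangle_fin n δ) hk,
    coeff_coeff_rect_eq_card δ (r := n * δ - k) (s := k) (by omega),
    card_filter_antitoneWeights_le_eq_boxPartitionCount]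
  split_ifs with hk0
  · rfl
  · rw [coeff_coeff_rect_eq_card δ (r := n * δ - k + 1) (s := k - 1) (by omega),
      card_filter_antitoneWeights_le_eq_boxPartitionCount]

/-- **Discharge of `BLMW2011_sylvester`** (Bürgisser–Landsberg–Manivel–Weyman 2011, (8.3.1),
"Sylvester's formula `k_{(δn-b,b),δⁿ,δⁿ} = P(b; δ×n) - P(b-1; δ×n)`"), from
`kroneckerCoeff_rectangle_rectangle_twoRow` and the transposition symmetry
`P(b; n×δ) = P(b; δ×n)` (`boxPartitionCount_symm`). [cite: BurgisserEtAl2011, §8.3 (8.3.1)] -/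
theorem BLMW2011_sylvester_holds : BLMW2011_sylvester := by
  intro n δ b hb
  have key := kroneckerCoeff_rectangle_rectangle_twoRow n δ b hb
  refine ⟨fun h1 => ?_, fun h0 => ?_⟩
  · rw [if_neg (by omega), boxPartitionCount_symm b, boxPartitionCount_symm (b - 1),
      ← numPartitionsInBox_eq_boxPartitionCount, ← numPartitionsInBox_eq_boxPartitionCount] at key
    omega
  · subst h0
    rw [if_pos rfl, sub_zero, boxPartitionCount_zero] at key
    exact_mod_cast key

end Literature.Computability.AlgebraicComplexity

end
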